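import Literature.Probability.Percolation.IsoradialCriticalityProofs
import Literature.Probability.Percolation.IsoradialUniverseTransfer
import HarnessLib

/-!
# `θ(P_G) = 0` from the box-crossing property, without a countability hypothesis

Topic `Literature/Probability/Percolation`; a proofs-only addendum to
`Literature.Probability.Percolation.IsoradialCriticalityProofs` (crit-perc.S24, the reduction of
Grimmett–Manolescu's Theorem "Criticality" (b) — PTRF 159 (2014) Thm 1.1(a), second half =
arXiv:1204.0505v2 §3 Thm 4(b): "there exists, `P_G`-a.s., no infinite open cluster" — to
their box-crossing Theorem, tree fact `gm_boxCrossing`).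

That file proves `gm_theta_critical_eq_zero_of_gm_boxCrossing : gm_boxCrossing G emb ε →
gm_theta_critical_eq_zero G emb ε` under a standing instance hypothesis `[Countable V]`, used
only to discard the null set of configurations containing non-edges. The named fact
`gm_theta_critical_eq_zero G emb ε` itself (file `Isoradial.lean`) carries **no** countability
hypothesis (unused instance variables are not part of a `def`), so a future discharge
`theorem gm_theta_critical_eq_zero_holds : gm_theta_critical_eq_zero G emb ε` from
`gm_boxCrossing_holds` needs the implication for *every* vertex type. This file supplies it:
the vertex set of a preconnected isoradial graph (rhombic tiling, BAP(ε), `ε > 0`) is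
countable — it is the union over `k ∈ ℕ` of the vertices drawn in the box `‖·‖_∞ ≤ k`, each
finite by the local finiteness proved in that file
(`IsoradialCriticality.finite_setOf_boxNorm_le`, the packing of the `sin² ε`-separated edge
midpoints; Grimmett–Manolescu 2014, §4.4 Prop. 7 / §2.1: isoradial graphs are locally finite
countable planar graphs) — whence the countability-free form
`percolatesAt_eq_zero_of_hasBoxCrossingProperty` of the reduction. The implication between
the two named facts with *exactly* their binders is then the two-liner
`fun h hconn hiso hrh hε hbap hsgp x => percolatesAt_eq_zero_of_hasBoxCrossingProperty emb
hconn hiso hrh hε hbap (h hconn hiso hrh hε hbap hsgp) x :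
gm_boxCrossing G emb ε → gm_theta_critical_eq_zero G emb ε` (not restated as a theorem here:
up to the instance binder it is `gm_theta_critical_eq_zero_of_gm_boxCrossing` of that file),
and likewise for the printed-SGP form `gm_theta_critical_eq_zero_printed_of_gm_boxCrossing`
(feed `hsgp.hasSquareGridProperty`).

Status of the fact (recorded by the `provefact` seats, 2026-08-15): its unconditional proof
needs GM's Theorem 3.1 (the box-crossing property over the class `𝒢`, §§5–7: star–triangle
transport), vendored as the unproved facts `gm_boxCrossing` (per graph) and
`gm_boxCrossingBounds_uniform` (printed uniform form, §3 (3.1)). The square-grid hypothesis of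
`gm_theta_critical_eq_zero` and `gm_boxCrossing`, originally the H21 rendering
`HasSquareGridProperty` (strictly weaker than the printed SGP(I), §4.2 — the verdict recorded in
`IsoradialCriticalityProofs`, section "The statement of `gm_theta_critical_eq_zero` against its
source"), was restated in place to the printed `HasSquareGridPropertyGM` later on 2026-08-15
(see the `History` paragraphs in `Isoradial.lean`); both facts are since then faithful to
Theorems 3 and 4 (b), and nothing in this file depends on which rendering they carry.

## The per-graph facts from the uniform fact, with exactly their binders

`IsoradialUniverseTransfer` derives the box-crossing property
(`gm_boxCrossingGM_of_gm_boxCrossingBounds_uniform`) and `θ(P_G) = 0`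
(`theta_eq_zero_of_gm_boxCrossingBounds_uniform_univ`), for graphs of the printed class on
vertex/face types in any universes, from the uniform fact `gm_boxCrossingBounds_uniform`
(Grimmett–Manolescu 2014, §3 (3.1): "if `G` satisfies BAP(ε) and SGP(I), `P_G` satisfies
BXP(δ)", `δ = δ(ε, I)`), under the standing instances `[Countable V]` and `[G.LocallyFinite]`
of the class. Both instances follow from the geometry — countability above, local finiteness in
`IsoradialCriticality.finite_neighborSet_of_hasBoundedAngles` (the neighbours of `v` are drawn
within sup-distance `2` of `z v`, `IsoradialCriticality.abs_sub_lt_two_of_adj`, in a finite set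
of vertices, `IsoradialCriticality.finite_setOf_boxNorm_le`; GM §4.4, proof of Prop. 7: "the
diameter of any such face is less than `2`") — so the uniform fact implies the two per-graph
facts *as elaborated* (binders `{V F} [DecidableEq V] [DecidableEq F] (G) (emb) (ε)`, no
instance hypotheses): `gm_boxCrossing_of_gm_boxCrossingBounds_uniform :
gm_boxCrossingBounds_uniform → gm_boxCrossing G emb ε` (Theorem 3 per graph from (3.1)) and
`gm_theta_critical_eq_zero_of_gm_boxCrossingBounds_uniform' : gm_boxCrossingBounds_uniform →
gm_theta_critical_eq_zero G emb ε` (Theorem 4 (b) from (3.1), through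
`percolatesAt_eq_zero_of_hasBoxCrossingProperty`). Hence the discharges of the two per-graph
facts are one-liners in `gm_boxCrossingBounds_uniform_holds` once that theorem exists, and
`gm_theta_critical_eq_zero_holds` is equally the two-liner above in `gm_boxCrossing_holds`.

## References

* G. R. Grimmett, I. Manolescu, *Bond percolation on isoradial graphs: criticality and
  universality*, Probab. Theory Related Fields 159 (2014) 273–327 = arXiv:1204.0505v2: §3
  Theorem 3 (box-crossing property) with (3.1), Theorem 4 (Criticality) (b) and its proof
  (end of §3); §2.1, §4.4 Prop. 7 and its proof (faces of diameter `< 2`; local finiteness);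
  §4.2 (SGP(I), SGP).
-/

noncomputable section

namespace Literature.Probability.Percolation

open LatticeModels

/-- **The vertex set of an isoradial graph with bounded angles is countable.** For a
preconnected graph, isoradially and rhombically embedded with BAP(ε), `ε > 0`: if it has at
least two vertices then every vertex has a neighbour, every box `‖z v‖_∞ ≤ k` contains finitely
many vertices (`IsoradialCriticality.finite_setOf_boxNorm_le`), and `V` is the union of these
boxes over `k ∈ ℕ`. (Grimmett–Manolescu 2014, §2.1 and §4.4 Prop. 7: isoradial graphs are
locally finite — hence countable — planar graphs.)
[cite: GrimmettManolescu2014Isoradial, §4.4 Prop. 7 (local finiteness; arXiv:1204.0505v2 numbering)] -/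
theorem IsoradialCriticality.countable_of_hasBoundedAngles {V F : Type*} {G : SimpleGraph V}
    (emb : RhombicEmbedding G F) {ε : ℝ} (hconn : G.Preconnected) (hiso : emb.IsIsoradial)
    (hrh : emb.IsRhombicTiling) (hε : 0 < ε) (hbap : emb.HasBoundedAngles ε) : Countable V := by
  classical
  rcases subsingleton_or_nontrivial V with hV | hV
  · infer_instance
  obtain ⟨v₀, u₀, hne⟩ := exists_pair_ne V
  have hnb : ∀ v : V, ∃ u, G.Adj v u := by
    obtain ⟨w⟩ := hconn v₀ u₀
    cases w with
    | nil => exact absurd rfl hne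
    | cons h _ => exact IsoradialCriticality.exists_adj_of_preconnected hconn h
  have hfin : ∀ k : ℕ, {v : V | (emb.z v - 0).boxNorm ≤ k}.Finite := fun k =>
    IsoradialCriticality.finite_setOf_boxNorm_le hiso hrh hbap hε hnb 0 k
  have hU : (Set.univ : Set V) = ⋃ k : ℕ, {v : V | (emb.z v - 0).boxNorm ≤ k} := by
    ext v
    simp only [Set.mem_univ, Set.mem_iUnion, Set.mem_setOf_eq, true_iff]
    exact ⟨⌈(emb.z v - 0).boxNorm⌉₊, Nat.le_ceil _⟩
  rw [← Set.countable_univ_iff, hU]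
  exact Set.countable_iUnion fun k => (hfin k).countable

/-- **The box-crossing property implies `θ(P_G) = 0`, for every vertex type.** Same statement
as `gm_theta_critical_eq_zero_of_hasBoxCrossingProperty` (Grimmett–Manolescu 2014, §3,
Theorem (Criticality) (b) from the box-crossing property, "as in [GM1]") without the instance
hypothesis `[Countable V]`, which is derived from the geometry
(`IsoradialCriticality.countable_of_hasBoundedAngles`).
[cite: GrimmettManolescu2014Isoradial, §3 Theorem 4 (Criticality) (b), proof at the end of §3 (arXiv:1204.0505v2)] -/
theorem percolatesAt_eq_zero_of_hasBoxCrossingProperty {V F : Type*} {G : SimpleGraph V}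
    (emb : RhombicEmbedding G F) {ε : ℝ} (hconn : G.Preconnected) (hiso : emb.IsIsoradial)
    (hrh : emb.IsRhombicTiling) (hε : 0 < ε) (hbap : emb.HasBoundedAngles ε)
    (hbxp : HasBoxCrossingProperty emb.isoradialPercolation emb.z) (x : V) :
    emb.isoradialPercolation (percolatesAt x) = 0 := by
  haveI := IsoradialCriticality.countable_of_hasBoundedAngles emb hconn hiso hrh hε hbap
  exact gm_theta_critical_eq_zero_of_hasBoxCrossingProperty emb hconn hiso hrh hε hbap hbxp x

/-! ### Local finiteness, and the per-graph facts from the uniform fact -/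

/-- **Isoradial graphs with bounded angles are locally finite.** For a preconnected graph,
isoradially and rhombically embedded with BAP(ε), `ε > 0`, every vertex `v` has finitely many
neighbours: each neighbour is drawn within sup-distance `2` of `z v` (every edge is a diagonal of
a non-degenerate rhombus with unit sides, `IsoradialCriticality.abs_sub_lt_two_of_adj`), and the
box `‖· - z v‖_∞ ≤ 2` contains finitely many vertices
(`IsoradialCriticality.finite_setOf_boxNorm_le`). (Grimmett–Manolescu 2014, §4.4, proof of
Prop. 7: "the diameter of any such face is less than `2`"; §2.1: isoradial graphs are locally
finite planar graphs. A `G.LocallyFinite` structure is then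
`fun v => (finite_neighborSet_of_hasBoundedAngles emb hconn hiso hrh hε hbap v).fintype`.)
[cite: GrimmettManolescu2014Isoradial, §4.4 proof of Prop. 7 (arXiv:1204.0505v2 numbering); §2.1] -/
theorem IsoradialCriticality.finite_neighborSet_of_hasBoundedAngles {V F : Type*}
    {G : SimpleGraph V} (emb : RhombicEmbedding G F) {ε : ℝ} (hconn : G.Preconnected)
    (hiso : emb.IsIsoradial) (hrh : emb.IsRhombicTiling) (hε : 0 < ε)
    (hbap : emb.HasBoundedAngles ε) (v : V) : (G.neighborSet v).Finite := by
  by_cases h : ∃ u, G.Adj v u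
  · obtain ⟨u, hu⟩ := h
    have hnb : ∀ w : V, ∃ u, G.Adj w u :=
      IsoradialCriticality.exists_adj_of_preconnected hconn hu
    refine (IsoradialCriticality.finite_setOf_boxNorm_le hiso hrh hbap hε hnb (emb.z v) 2).subset
      ?_
    intro w hw
    obtain ⟨hre, him⟩ :=
      IsoradialCriticality.abs_sub_lt_two_of_adj hiso ((SimpleGraph.mem_neighborSet G v w).1 hw).symm
    show (emb.z w - emb.z v).boxNorm ≤ 2
    unfold Complex.boxNorm
    rw [Complex.sub_re, Complex.sub_im]
    exact max_le hre.le him.le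
  · exact Set.finite_empty.subset fun w hw => (h ⟨w, (SimpleGraph.mem_neighborSet G v w).1 hw⟩).elim

section Uniform

variable {V F : Type*} [DecidableEq V] [DecidableEq F] (G : SimpleGraph V)
  (emb : RhombicEmbedding G F) (ε : ℝ)

/-- **The uniform fact (3.1) implies the per-graph fact `gm_boxCrossing`, with exactly its
binders.** Grimmett–Manolescu's Theorem 3 per graph ("For `G ∈ 𝒢`, `P_G` possesses the
box-crossing property") from its printed uniform form `gm_boxCrossingBounds_uniform` (§3 (3.1):
"for `ε > 0` and `I ∈ ℕ` there exists `δ = δ(ε, I) > 0` such that if `G` satisfies BAP(ε) and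
SGP(I), `P_G` satisfies BXP(δ)"), for vertex/face types in any universes and *without* the
instance hypotheses `[Countable V]`, `[G.LocallyFinite]` of
`gm_boxCrossingGM_of_gm_boxCrossingBounds_uniform` (`IsoradialUniverseTransfer`), which are
derived from the geometry (`IsoradialCriticality.countable_of_hasBoundedAngles`,
`IsoradialCriticality.finite_neighborSet_of_hasBoundedAngles`). With
`gm_boxCrossingBounds_uniform_holds` in hand, `gm_boxCrossing_holds` is this theorem applied to it.
[cite: GrimmettManolescu2014Isoradial, §3 Theorem 3 (box-crossing property for 𝒢) with (3.1) (arXiv:1204.0505v2); §4.2 (SGP(I), SGP)] -/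
theorem gm_boxCrossing_of_gm_boxCrossingBounds_uniform (huf : gm_boxCrossingBounds_uniform) :
    gm_boxCrossing G emb ε := fun hconn hiso hrh hε hbap hsgp => by
  haveI : Countable V :=
    IsoradialCriticality.countable_of_hasBoundedAngles emb hconn hiso hrh hε hbap
  letI : G.LocallyFinite := fun v =>
    (IsoradialCriticality.finite_neighborSet_of_hasBoundedAngles emb hconn hiso hrh hε hbap v).fintype
  exact gm_boxCrossingGM_of_gm_boxCrossingBounds_uniform G emb huf ε hconn hiso hrh hε hbap hsgp

/-- **The uniform fact (3.1) implies the per-graph fact `gm_theta_critical_eq_zero`, with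
exactly its binders.** Grimmett–Manolescu's Theorem 4 (Criticality) (b) ("Let `G ∈ 𝒢` […].
There exists, `P_G`-a.s., no infinite open cluster", rendered vertexwise) from the printed
uniform box-crossing statement `gm_boxCrossingBounds_uniform` (§3 (3.1)), for vertex/face types
in any universes and without instance hypotheses: the box-crossing property per graph
(`gm_boxCrossing_of_gm_boxCrossingBounds_uniform`), then the printed deduction "Theorem 3 ⇒
Theorem 4 (b)" (end of §3, "as in [GM1]") in its countability-free form
`percolatesAt_eq_zero_of_hasBoxCrossingProperty`. Compare
`gm_theta_critical_eq_zero_of_gm_boxCrossingBounds_uniform` (`IsoradialCriticalityProofs`: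
graphs in `Type`, SGP(I), under `[Countable V] [G.LocallyFinite]`) and
`theta_eq_zero_of_gm_boxCrossingBounds_uniform_univ` (`IsoradialUniverseTransfer`: any
universes, same instances). With `gm_boxCrossingBounds_uniform_holds` in hand,
`gm_theta_critical_eq_zero_holds` is this theorem applied to it.
[cite: GrimmettManolescu2014Isoradial, §3 Theorem 4 (Criticality) (b), proof at the end of §3, with (3.1) (arXiv:1204.0505v2)] -/
theorem gm_theta_critical_eq_zero_of_gm_boxCrossingBounds_uniform'
    (huf : gm_boxCrossingBounds_uniform) : gm_theta_critical_eq_zero G emb ε :=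
  fun hconn hiso hrh hε hbap hsgp x =>
    percolatesAt_eq_zero_of_hasBoxCrossingProperty emb hconn hiso hrh hε hbap
      (gm_boxCrossing_of_gm_boxCrossingBounds_uniform G emb ε huf hconn hiso hrh hε hbap hsgp) x

end Uniform

end Literature.Probability.Percolation
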